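import Mathlib
import HarnessLib
import Literature.Probability.Process.PointStationaryLaw
import Literature.Probability.Process.RootedHardCoreVague
import Summits.AtomisticToContinuum.Crystallization.Theorems.PalmUnimodularRigidityBenjaminiSchrammLimitCampbell

/-!
# Ergodic reduction for the crux `AperiodicFrustratedLawGap` — Mecke identity ⇒ Campbell invariance

Route `FrustratedLawDichotomy`, crux `AperiodicFrustratedLawGap` (item `stmt-AtomisticToContinuum-27623`),
registered stub `stub_ergodicReduction` (skeleton `dd3251ad731e`).  Companion of
`FrustratedLawDichotomyAperiodicFrustratedLawGapErgodicReduction` / `…ErgodicPullback` (steps D1/D2/D6 of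
the ergodic-decomposition plan recorded there).  Step D0:

* `map_reroot_compProd_eq_of_isPointStationaryLaw` — **the converse of
  `BenjaminiSchrammLimit.isPointStationaryLaw_map_toMeasure`.**  If the push-forward `Q.map ι` of a finite
  law `Q` on the compact space of rooted `δ`-hard-core configurations of `ℝ³` along the counting-measure
  embedding `ι : S ↦ count|S` satisfies the Mecke / mass-transport identity `IsPointStationaryLaw`, then the
  CAMPBELL MEASURE `Q ⊗ₘ κ₀` (`κ₀ S = count|S`) is invariant under the re-rooting involution
  `Θ (S, y) = (S - y, -y)`.  Test the Mecke identity with `g(μ, y) = 1_C(e μ, y)` for a measurable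
  `C ⊆ (configurations) × ℝ³`, `e` a measurable left inverse of `ι` (Lusin–Souslin,
  `MeasurableEmbedding.measurable_extend`): the two sides are `(Q ⊗ₘ κ₀) C` and `(Q ⊗ₘ κ₀) (Θ⁻¹ C)`.

So on the configuration space "point-stationary" and "Campbell-invariant" are the same thing; the
conditioning steps of the plan (a.e. Campbell-invariance and a.e. ergodicity of the conditional laws given
the re-rooting-invariant σ-algebra) can therefore be run entirely on the standard Borel space
`RootedHardCoreConfig ℝ³ δ`.  `[folklore]` (Mecke 1967; Last–Penrose, *Lectures on the Poisson
process*, Ch. 9; Aldous–Lyons 2007 §2).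
-/

noncomputable section

namespace Summit.AtomisticToContinuum.Crystallization.Theorems.FrustratedLawDichotomyErgodicReduction

open MeasureTheory Set Filter ProbabilityTheory
open scoped ENNReal Classical
open Literature.Probability.Process (IsRootedHardCore IsPointStationaryLaw LocalConfig)
open Literature.Probability.Process.LocalConfig (RootedHardCoreConfig toMeasure_def measurable_toMeasure)
open Summit.AtomisticToContinuum.Crystallization.Theorems.BenjaminiSchrammLimit (measurableEmbedding_toMeasure
  isSFiniteKernel_toMeasure measurable_reroot)

variable {δ : ℝ}

/-- The one-point configuration `{0}`: the configuration space is nonempty. [folklore] -/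
theorem nonempty_rootedHardCoreConfig (δ : ℝ) :
    Nonempty (RootedHardCoreConfig (EuclideanSpace ℝ (Fin 3)) δ) :=
  ⟨⟨LocalConfig.mk {0}, Set.mem_singleton _, fun x hx y hy hxy =>
    (hxy ((show x = 0 from hx).trans (show y = 0 from hy).symm)).elim⟩⟩

/-- **Mecke identity ⇒ Campbell invariance** (converse of `isPointStationaryLaw_map_toMeasure`, `δ > 0`).
If `Q` is a finite law on rooted `δ`-hard-core configurations of `ℝ³` whose push-forward along
`ι : S ↦ count|S` is point-stationary, then the Campbell measure `Q ⊗ₘ κ₀` (`κ₀ S = count|S`) is invariant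
under the re-rooting involution `Θ (S, y) = (S - y, -y)` (junk value `(S, -y)` for `y ∉ S`). [folklore] -/
theorem map_reroot_compProd_eq_of_isPointStationaryLaw [Fact (0 < δ)]
    {Q : Measure (RootedHardCoreConfig (EuclideanSpace ℝ (Fin 3)) δ)} [IsFiniteMeasure Q]
    (hstat : IsPointStationaryLaw (Q.map fun S : RootedHardCoreConfig (EuclideanSpace ℝ (Fin 3)) δ =>
      (S.1 : LocalConfig (EuclideanSpace ℝ (Fin 3))).toMeasure)) :
    haveI := isSFiniteKernel_toMeasure (E := EuclideanSpace ℝ (Fin 3)) (δ := δ)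
    (Q ⊗ₘ (⟨fun S : RootedHardCoreConfig (EuclideanSpace ℝ (Fin 3)) δ =>
        (S.1 : LocalConfig (EuclideanSpace ℝ (Fin 3))).toMeasure,
        measurable_toMeasure (Fact.out : 0 < δ)⟩ :
        Kernel (RootedHardCoreConfig (EuclideanSpace ℝ (Fin 3)) δ) (EuclideanSpace ℝ (Fin 3)))).map
      (fun p : RootedHardCoreConfig (EuclideanSpace ℝ (Fin 3)) δ × EuclideanSpace ℝ (Fin 3) =>
        ((if h : p.2 ∈ ((p.1.1 : LocalConfig (EuclideanSpace ℝ (Fin 3))) : Set (EuclideanSpace ℝ (Fin 3)))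
          then p.1.reroot p.2 h else p.1 : RootedHardCoreConfig (EuclideanSpace ℝ (Fin 3)) δ), -p.2)) =
    Q ⊗ₘ (⟨fun S : RootedHardCoreConfig (EuclideanSpace ℝ (Fin 3)) δ =>
        (S.1 : LocalConfig (EuclideanSpace ℝ (Fin 3))).toMeasure,
        measurable_toMeasure (Fact.out : 0 < δ)⟩ :
        Kernel (RootedHardCoreConfig (EuclideanSpace ℝ (Fin 3)) δ) (EuclideanSpace ℝ (Fin 3))) := by
  haveI := isSFiniteKernel_toMeasure (E := EuclideanSpace ℝ (Fin 3)) (δ := δ)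
  have hδ : 0 < δ := Fact.out
  have hE := measurableEmbedding_toMeasure (EuclideanSpace ℝ (Fin 3)) (δ := δ)
  have hΘ : Measurable (fun p : RootedHardCoreConfig (EuclideanSpace ℝ (Fin 3)) δ × EuclideanSpace ℝ (Fin 3) =>
      ((if h : p.2 ∈ ((p.1.1 : LocalConfig (EuclideanSpace ℝ (Fin 3))) : Set (EuclideanSpace ℝ (Fin 3)))
        then p.1.reroot p.2 h else p.1 : RootedHardCoreConfig (EuclideanSpace ℝ (Fin 3)) δ), -p.2)) :=
    measurable_reroot hδ
  -- a measurable left inverse of the embedding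
  obtain ⟨S₀⟩ := nonempty_rootedHardCoreConfig δ
  set e : Measure (EuclideanSpace ℝ (Fin 3)) → RootedHardCoreConfig (EuclideanSpace ℝ (Fin 3)) δ :=
    Function.extend (fun S : RootedHardCoreConfig (EuclideanSpace ℝ (Fin 3)) δ =>
      (S.1 : LocalConfig (EuclideanSpace ℝ (Fin 3))).toMeasure) id (fun _ => S₀) with he_def
  have he : Measurable e := hE.measurable_extend measurable_id measurable_const
  have he_apply : ∀ S : RootedHardCoreConfig (EuclideanSpace ℝ (Fin 3)) δ,
      e ((S.1 : LocalConfig (EuclideanSpace ℝ (Fin 3))).toMeasure) = S := fun S =>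
    hE.injective.extend_apply _ _ S
  refine Measure.ext fun C hC => ?_
  -- the tested function `g(μ, y) = 1_C(e μ, y)`
  set g : Measure (EuclideanSpace ℝ (Fin 3)) → EuclideanSpace ℝ (Fin 3) → ℝ≥0∞ :=
    fun μ y => C.indicator (fun _ => (1 : ℝ≥0∞)) (e μ, y) with hg_def
  have hg : Measurable (Function.uncurry g) :=
    (measurable_const.indicator hC).comp ((he.comp measurable_fst).prodMk measurable_snd)
  have key := hstat g hg
  rw [hE.lintegral_map, hE.lintegral_map] at key
  -- left-hand side of the Mecke identity: the Campbell measure of `C`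
  have hL : ∫⁻ S : RootedHardCoreConfig (EuclideanSpace ℝ (Fin 3)) δ,
      ∫⁻ y, g ((S.1 : LocalConfig (EuclideanSpace ℝ (Fin 3))).toMeasure) y
        ∂((S.1 : LocalConfig (EuclideanSpace ℝ (Fin 3))).toMeasure) ∂Q =
      (Q ⊗ₘ (⟨fun S : RootedHardCoreConfig (EuclideanSpace ℝ (Fin 3)) δ =>
        (S.1 : LocalConfig (EuclideanSpace ℝ (Fin 3))).toMeasure,
        measurable_toMeasure (Fact.out : 0 < δ)⟩ :
        Kernel (RootedHardCoreConfig (EuclideanSpace ℝ (Fin 3)) δ) (EuclideanSpace ℝ (Fin 3)))) C := by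
    rw [Measure.compProd_apply hC]
    refine lintegral_congr fun S => ?_
    rw [Kernel.coe_mk, ← lintegral_indicator_one (measurable_prodMk_left hC)]
    refine lintegral_congr fun y => ?_
    simp only [hg_def, he_apply, Set.indicator_apply, Set.mem_preimage, Pi.one_apply]
  -- right-hand side: the Campbell measure of `Θ ⁻¹' C`
  have hR : ∫⁻ S : RootedHardCoreConfig (EuclideanSpace ℝ (Fin 3)) δ,
      ∫⁻ y, g (((S.1 : LocalConfig (EuclideanSpace ℝ (Fin 3))).toMeasure).map
          (fun z : EuclideanSpace ℝ (Fin 3) => z - y)) (-y)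
        ∂((S.1 : LocalConfig (EuclideanSpace ℝ (Fin 3))).toMeasure) ∂Q =
      ((Q ⊗ₘ (⟨fun S : RootedHardCoreConfig (EuclideanSpace ℝ (Fin 3)) δ =>
        (S.1 : LocalConfig (EuclideanSpace ℝ (Fin 3))).toMeasure,
        measurable_toMeasure (Fact.out : 0 < δ)⟩ :
        Kernel (RootedHardCoreConfig (EuclideanSpace ℝ (Fin 3)) δ) (EuclideanSpace ℝ (Fin 3)))).map
      (fun p : RootedHardCoreConfig (EuclideanSpace ℝ (Fin 3)) δ × EuclideanSpace ℝ (Fin 3) =>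
        ((if h : p.2 ∈ ((p.1.1 : LocalConfig (EuclideanSpace ℝ (Fin 3))) : Set (EuclideanSpace ℝ (Fin 3)))
          then p.1.reroot p.2 h else p.1 : RootedHardCoreConfig (EuclideanSpace ℝ (Fin 3)) δ), -p.2))) C := by
    rw [Measure.map_apply hΘ hC, Measure.compProd_apply (hΘ hC)]
    refine lintegral_congr fun S => ?_
    rw [Kernel.coe_mk, ← lintegral_indicator_one (measurable_prodMk_left (hΘ hC)), toMeasure_def]
    refine setLIntegral_congr_fun (RootedHardCoreConfig.isClosed_coe hδ S).measurableSet fun y hy => ?_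
    have h1 : ((Measure.count : Measure (EuclideanSpace ℝ (Fin 3))).restrict
        ((S.1 : LocalConfig (EuclideanSpace ℝ (Fin 3))) : Set (EuclideanSpace ℝ (Fin 3)))).map
          (fun z : EuclideanSpace ℝ (Fin 3) => z - y) =
        ((S.reroot y hy).1 : LocalConfig (EuclideanSpace ℝ (Fin 3))).toMeasure := by
      rw [RootedHardCoreConfig.toMeasure_reroot, toMeasure_def]
    rw [h1]
    simp only [hg_def, he_apply, Set.indicator_apply, Set.mem_preimage, Pi.one_apply, dif_pos hy]
  rw [hL, hR] at key
  exact key.symm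

end Summit.AtomisticToContinuum.Crystallization.Theorems.FrustratedLawDichotomyErgodicReduction

end
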